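import Summits.ValiantsHypothesis.ValiantsHypothesis.Theses.LacunarySymmetroid

/-!
# `LacunarySymmetroid.PencilTransfer` is false without its `IsVPFamily` hypothesis

Negative (load-bearing) lemma for the crux `PencilTransfer` (item stmt-ValiantsHypothesis-18051,
route `LacunarySymmetroid`), filed by the refuter crux-attack seat. The crux says: for a real family
`f_n` whose complexification is a `VP` family and exponents `d_n`, uniformly in `n` (one constant `c`)
some real symmetric lacunary pencil of quasi-polynomial size `m ≤ 2^((log₂ n + c)^c)` has a determinant
with the same real zero SET as `f_n(X^{d_{n,i}})`.

Dropping the hypothesis makes it false: the one-variable family `f_n = ∏_{j < N(n)} (x₀ - j)` with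
`N(n) = 2^((2n)^n) + 1`, restricted along `x₀ = X¹`, has `N(n)` distinct real zeros, while a two-term
pencil `S₀ + X • S₁` of size `m` has a determinant of degree `≤ m`
(`Polynomial.natDegree_det_X_add_C_le`), hence at most `m ≤ 2^((log₂ n + c)^c) < N(n)` distinct real
zeros at `n = c + 1`. So any proof of `PencilTransfer` must use the hypothesis, and what it must extract
from it is a degree-type (determinantal-complexity) bound that is quasi-polynomial UNIFORMLY in `n`;
the pointwise statement (`∀ n, ∃ c`) is hypothesis-free by Valiant universality.
-/

namespace Summit.ValiantsHypothesis.Theorems.PencilTransfer.Negative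

open Polynomial

/-- The restriction of `∏_{j<N} (x₀ - j)` along `x₀ = X` is `∏_{a ∈ {0,…,N-1}} (X - a)`. [folklore] -/
theorem aeval_prod_X_sub_natCast (N : ℕ) :
    MvPolynomial.aeval (fun _ : Fin 1 => (X : ℝ[X]) ^ 1)
        (∏ j ∈ Finset.range N, (MvPolynomial.X 0 - MvPolynomial.C (j : ℝ))) =
      ((Finset.range N).image (fun j : ℕ => (j : ℝ))).prod (fun a => X - C a) := by
  rw [Finset.prod_image (fun a _ b _ h => by exact_mod_cast h)]
  simp [map_prod]

/-- `∏_{j<N} (x₀ - j)` restricted along `x₀ = X` has exactly `N` distinct real zeros. [folklore] -/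
theorem card_roots_toFinset_prod_X_sub_natCast (N : ℕ) :
    (MvPolynomial.aeval (fun _ : Fin 1 => (X : ℝ[X]) ^ 1)
        (∏ j ∈ Finset.range N, (MvPolynomial.X 0 - MvPolynomial.C (j : ℝ)))).roots.toFinset.card = N := by
  rw [aeval_prod_X_sub_natCast, Polynomial.roots_prod_X_sub_C, Finset.val_toFinset,
    Finset.card_image_of_injective _ Nat.cast_injective, Finset.card_range]

/-- **Two-term sector, linear case.** A two-term pencil `S₀ + X • S₁` of size `m` (exponents `0, 1`,
in the `Fin.cons` format of `PencilTransfer`) has at most `m` distinct real zeros of its determinant: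
`deg det (X • S₁ + S₀) ≤ m` (`Polynomial.natDegree_det_X_add_C_le`). [folklore] -/
theorem card_roots_toFinset_twoTermPencil_le (m : ℕ) (S : Fin (1 + 1) → Matrix (Fin m) (Fin m) ℝ) :
    (Matrix.det (∑ l, ((X : ℝ[X]) ^ (Fin.cons (α := fun _ => ℕ) (0 : ℕ) (fun _ : Fin 1 => 1) l)) •
      (S l).map C)).roots.toFinset.card ≤ m := by
  have hsum : (∑ l, ((X : ℝ[X]) ^ (Fin.cons (α := fun _ => ℕ) (0 : ℕ) (fun _ : Fin 1 => 1) l)) •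
      (S l).map C) = (X : ℝ[X]) • (S 1).map C + (S 0).map C := by
    rw [Fin.sum_univ_two, add_comm]
    simp only [Fin.cons_zero, pow_zero, one_smul]
    congr 1
    have h1 : (Fin.cons (α := fun _ => ℕ) (0 : ℕ) (fun _ : Fin 1 => 1) (1 : Fin (1 + 1))) = 1 :=
      Fin.cons_succ (α := fun _ => ℕ) (0 : ℕ) (fun _ : Fin 1 => 1) 0
    rw [h1, pow_one]
  rw [hsum]
  calc _ ≤ (Matrix.det ((X : ℝ[X]) • (S 1).map C + (S 0).map C)).roots.card :=
        Multiset.toFinset_card_le _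
    _ ≤ (Matrix.det ((X : ℝ[X]) • (S 1).map C + (S 0).map C)).natDegree := Polynomial.card_roots' _
    _ ≤ Fintype.card (Fin m) := Polynomial.natDegree_det_X_add_C_le _ _
    _ = m := Fintype.card_fin m

/-- Growth bookkeeping: at `n = c + 1` the quasi-polynomial exponent `(log₂ n + c)^c` is at most
`(2n)^n`. [folklore] -/
theorem log_add_pow_le (c : ℕ) : (Nat.log 2 (c + 1) + c) ^ c ≤ (2 * (c + 1)) ^ (c + 1) := by
  have hlog : Nat.log 2 (c + 1) ≤ c + 1 := Nat.log_le_self 2 (c + 1)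
  calc (Nat.log 2 (c + 1) + c) ^ c ≤ (2 * (c + 1)) ^ c := Nat.pow_le_pow_left (by omega) c
    _ ≤ (2 * (c + 1)) ^ (c + 1) := Nat.pow_le_pow_right (by omega) (Nat.le_succ c)

/-- **`PencilTransfer` with the `IsVPFamily` hypothesis dropped is false** (load-bearing lemma for
the crux `LacunarySymmetroid.PencilTransfer`): witness `v = 1`, `f_n = ∏_{j < 2^((2n)^n)+1} (x₀ - j)`,
`d_{n,0} = 1`; at `n = c + 1` the restriction has `2^((2n)^n) + 1 > 2^((log₂ n + c)^c) ≥ m` distinct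
real zeros, more than any two-term pencil of size `m` (`card_roots_toFinset_twoTermPencil_le`).
Hence any proof of the crux must use the hypothesis (through a determinantal-complexity /
degree bound uniform in `n`). [folklore] -/
theorem pencilTransfer_false_without_isVPFamily :
    ¬ (∀ (v : ℕ → ℕ) (f : ∀ n, MvPolynomial (Fin (v n)) ℝ),
        ∀ d : (n : ℕ) → Fin (v n) → ℕ, ∃ c : ℕ, ∀ n : ℕ, ∃ m : ℕ, m ≤ 2 ^ ((Nat.log 2 n + c) ^ c) ∧
          ∃ S : Fin (v n + 1) → Matrix (Fin m) (Fin m) ℝ, (∀ l, (S l).IsSymm) ∧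
            (Matrix.det (∑ l, ((Polynomial.X : Polynomial ℝ) ^
                (Fin.cons (α := fun _ => ℕ) (0 : ℕ) (d n) l)) • (S l).map Polynomial.C)).roots.toFinset =
            (MvPolynomial.aeval (fun i => (Polynomial.X : Polynomial ℝ) ^ d n i) (f n)).roots.toFinset) := by
  intro h
  obtain ⟨c, hc⟩ := h (fun _ => 1)
    (fun n => ∏ j ∈ Finset.range (2 ^ ((2 * n) ^ n) + 1), (MvPolynomial.X 0 - MvPolynomial.C (j : ℝ)))
    (fun _ _ => 1)
  obtain ⟨m, hm, S, -, hroots⟩ := hc (c + 1)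
  have hR := card_roots_toFinset_prod_X_sub_natCast (2 ^ ((2 * (c + 1)) ^ (c + 1)) + 1)
  rw [← hroots] at hR
  have hle := card_roots_toFinset_twoTermPencil_le m S
  rw [hR] at hle
  have h2 : 2 ^ ((Nat.log 2 (c + 1) + c) ^ c) ≤ 2 ^ ((2 * (c + 1)) ^ (c + 1)) :=
    Nat.pow_le_pow_right (by norm_num) (log_add_pow_le c)
  omega

end Summit.ValiantsHypothesis.Theorems.PencilTransfer.Negative
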